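import Literature.Computability.Complexity.DrivenSignMachineCarry
import Literature.Computability.Complexity.DrivenSignMachineUnflat
import Literature.Computability.Complexity.CodeFPArith
import Literature.Computability.Complexity.CodeFPStrings
import Literature.Computability.Complexity.NPClosureProofs
import HarnessLib

/-!
# Fournier–Koiran transfer: every polynomial one-bit protocol with `NP` and sign queries runs in `P⁰_ℝovs(NP)`

Topic `Literature/Computability/Complexity`, grouping namespace `FKTransfer`. The machine side of
Fournier–Koiran's Theorem 3 (ICALP 2000 = LIP RR-1999-21, p. 11: `NP⁰_ℝovs ⊆ P⁰_ℝovs(NP)`), in the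
form the point-location protocol of §2 is consumed. A ONE-BIT PROTOCOL asks, in dimension `n`,
`K(n)` questions whose statements depend on the answers `prev` received so far: either an `NP`
question "`⟨1ⁿ, prev⟩ ∈ Lnp`?" (when `isNP n prev`), or a SIGN question "is the affine form coded by
`qry n prev` non-negative at the input `x`?"; at the end a last `NP` statement "`⟨1ⁿ, answers⟩ ∈ Lfin`"
is the verdict. **`mem_PAddRelClass_NP_of_protocol`**: if the selector and the query code are
polynomial-time (`CodeFP`), the query codes have length `m(n)`, and `Lnp, Lfin ∈ NP`, then every real
language whose membership is the verdict of the protocol run against `signEnv x` is in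
`PAddRelClass NP` (`P⁰_ℝovs(NP)`).

The proof drives the universal sign machine of `DrivenSignMachine*.lean` (one frame per question:
the witness found by prefix search is `a :: qry n prev`, its head `a` being the `NP` answer — the
search driver prefers `1`, so `a = [⟨1ⁿ, prev⟩ ∈ Lnp]` — and its tail the probe transmitted to the
sign round, `DrivenSignMachineCarry.lean`); the driver language is assembled from `Lnp`, `Lfin` and
polynomial-time readings of the transcript (`histOf`, a `CodeFP.foldl` recovering `prev`), and is in
`NP` by the closure properties of `Σ₁ᵖ` (`NPClosureProofs.lean`). The report's own protocol (§2:
binary search, `NP` prefix searches, the tests `x = s`, the final `NP` question) is such a protocol;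
this file is the part of Theorem 3 the report calls "tedious but completely straightforward" (p. 4).

## References

* H. Fournier, P. Koiran, *Lower bounds are not easier over the reals: inside PH*, ICALP 2000,
  LNCS 1853 = LIP RR-1999-21, §2 (p. 4: simulating `NP`-oracle and sign queries), §3 Thm 3 (p. 11).
  [FournierKoiran2000]
* S. Arora, B. Barak, *Computational Complexity: A Modern Approach*, CUP 2009, §1.3, Def. 5.3
  (closure properties). [AroraBarak2009]
-/

namespace Literature.Computability.Complexity

namespace FKTransfer

open _root_.Computability Polynomial CodeFP Brick

/-- Length of a unary numeral. [folklore] -/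
private theorem length_unaryEncodeNat (k : ℕ) : (unaryEncodeNat k).length = k := length_unE k

/-! ### One-bit protocols: the answer stream -/

section Semantics

variable (isNP : ℕ → List Bool → Bool) (qry : ℕ → List Bool → List Bool) (Lnp : Language Bool)

open Classical in
/-- **The next answer** of the protocol in dimension `n` after the answers `prev`, against the sign
environment `σ`: the truth of the `NP` statement `⟨1ⁿ, prev⟩ ∈ Lnp` on an `NP` question, the sign bit
of the probe `qry n prev` otherwise. [cite: FournierKoiran2000, §2 (p. 4)] -/
noncomputable def nextAns (σ : List Bool → Bool) (n : ℕ) (prev : List Bool) : Bool :=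
  if isNP n prev then decide (boolPair (unaryEncodeNat n) prev ∈ Lnp) else σ (qry n prev)

/-- **The answers to the first `t` questions.** [cite: FournierKoiran2000, §2] -/
noncomputable def answers (σ : List Bool → Bool) (n : ℕ) : ℕ → List Bool
  | 0 => []
  | t + 1 => answers σ n t ++ [nextAns isNP qry Lnp σ n (answers σ n t)]

variable {isNP qry Lnp}

/-- Unfolding (`answers_zero`). [folklore] -/
@[simp] theorem answers_zero (σ : List Bool → Bool) (n : ℕ) : answers isNP qry Lnp σ n 0 = [] := rfl

/-- Unfolding (`answers_succ`). [folklore] -/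
theorem answers_succ (σ : List Bool → Bool) (n t : ℕ) :
    answers isNP qry Lnp σ n (t + 1) = answers isNP qry Lnp σ n t ++ [nextAns isNP qry Lnp σ n (answers isNP qry Lnp σ n t)] :=
  rfl

/-- `t` questions, `t` answers. [folklore] -/
@[simp] theorem length_answers (σ : List Bool → Bool) (n : ℕ) : ∀ t, (answers isNP qry Lnp σ n t).length = t
  | 0 => rfl
  | t + 1 => by rw [answers_succ, List.length_append, length_answers σ n t, List.length_singleton]

end Semantics

/-! ### The frame strategy of a protocol -/

section Strategy

variable (isNP : ℕ → List Bool → Bool) (qry : ℕ → List Bool → List Bool) (Lnp : Language Bool)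

/-- **The answers read off a history** of the driven machine: the head of the witness on an `NP`
question, the sign bit otherwise. [cite: FournierKoiran2000, §2 (p. 4)] -/
def prevOf (n : ℕ) (h : List (List Bool × Bool)) : List Bool :=
  h.foldl (fun p e => p ++ [if isNP n p then e.1.headD false else e.2]) []

/-- **Admissible witnesses**: `a :: qry n prev`, where the head may be `1` only if the current
question is an `NP` question with a true statement. [cite: FournierKoiran2000, §2 (p. 4)] -/
def protoR (n : ℕ) (h : List (List Bool × Bool)) (w : List Bool) : Prop :=
  ∃ a : Bool, w = a :: qry n (prevOf isNP n h) ∧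
    (a = true → isNP n (prevOf isNP n h) = true ∧ boolPair (unaryEncodeNat n) (prevOf isNP n h) ∈ Lnp)

variable {isNP qry Lnp}

/-- Unfolding (`prevOf_nil`). [folklore] -/
@[simp] theorem prevOf_nil (n : ℕ) : prevOf isNP n [] = [] := rfl

/-- Unfolding (`prevOf_append_singleton`). [folklore] -/
theorem prevOf_append_singleton (n : ℕ) (h : List (List Bool × Bool)) (e : List Bool × Bool) :
    prevOf isNP n (h ++ [e]) = prevOf isNP n h ++ [if isNP n (prevOf isNP n h) then e.1.headD false else e.2] := by
  simp [prevOf, List.foldl_append]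

/-- One answer per frame. [folklore] -/
@[simp] theorem length_prevOf (n : ℕ) (h : List (List Bool × Bool)) : (prevOf isNP n h).length = h.length := by
  induction h using List.reverseRecOn with
  | nil => rfl
  | append_singleton h e ih => rw [prevOf_append_singleton, List.length_append, ih, List.length_append]; rfl

/-- Admissible witnesses have length `m + 1`. [folklore] -/
theorem length_of_protoR {n m : ℕ} (hq : ∀ prev, (qry n prev).length = m) {h : List (List Bool × Bool)} {w : List Bool}
    (hw : protoR isNP qry Lnp n h w) : w.length = m + 1 := by
  obtain ⟨a, rfl, -⟩ := hw
  rw [List.length_cons, hq]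

/-- An admissible witness always exists (head `0`). [folklore] -/
theorem exists_protoR {n m : ℕ} (hq : ∀ prev, (qry n prev).length = m) (h : List (List Bool × Bool)) :
    ∃ w : List Bool, w.length = m + 1 ∧ protoR isNP qry Lnp n h w :=
  ⟨false :: qry n (prevOf isNP n h), by rw [List.length_cons, hq], false, rfl, fun hf => absurd hf Bool.false_ne_true⟩

/-- **The prefix-search questions of the strategy.** `p1` extends to an admissible witness iff:
when `p` is empty or starts with `1`, the question is an `NP` question with a true statement; and,
when `p` is non-empty, `p.tail ++ [1]` is a prefix of the probe. [cite: FournierKoiran2000, §2.1 (prefix search)] -/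
theorem prefixExtendable_protoR_iff {n m : ℕ} (hq : ∀ prev, (qry n prev).length = m)
    (h : List (List Bool × Bool)) (p : List Bool) :
    PrefixExtendable (protoR isNP qry Lnp n h) (m + 1) (p ++ [true]) ↔
      (p.headD true = true → isNP n (prevOf isNP n h) = true ∧ boolPair (unaryEncodeNat n) (prevOf isNP n h) ∈ Lnp) ∧
      (p ≠ [] → p.tail ++ [true] <+: qry n (prevOf isNP n h)) := by
  constructor
  · rintro ⟨w, -, hpw, a, rfl, ha⟩
    cases p with
    | nil =>
      obtain ⟨t, ht⟩ := hpw
      have hat : a = true := by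
        simp only [List.nil_append, List.singleton_append, List.cons.injEq] at ht
        exact ht.1.symm
      exact ⟨fun _ => ha hat, fun hne => absurd rfl hne⟩
    | cons c p' =>
      obtain ⟨t, ht⟩ := hpw
      simp only [List.cons_append, List.append_assoc, List.cons.injEq] at ht
      obtain ⟨rfl, ht⟩ := ht
      exact ⟨fun hc => ha hc, fun _ => ⟨t, by rw [← ht]; simp⟩⟩
  · rintro ⟨h1, h2⟩
    cases p with
    | nil =>
      exact ⟨true :: qry n (prevOf isNP n h), by rw [List.length_cons, hq], ⟨qry n (prevOf isNP n h), rfl⟩,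
        true, rfl, fun _ => h1 rfl⟩
    | cons c p' =>
      obtain ⟨t, ht⟩ := h2 (List.cons_ne_nil _ _)
      refine ⟨c :: qry n (prevOf isNP n h), by rw [List.length_cons, hq], ⟨t, ?_⟩, c, rfl, fun hc => h1 hc⟩
      rw [← ht]
      simp

open Classical in
/-- **The answers of a valid history are the answers of the protocol**, provided the heads of the
witnesses of the `NP` frames are the truth values of their statements. [cite: FournierKoiran2000, §2 (p. 4)] -/
theorem prevOf_take_eq_answers {σ : List Bool → Bool} {n m : ℕ} (hq : ∀ prev, (qry n prev).length = m)
    {h : List (List Bool × Bool)} (hv : ValidHist (protoR isNP qry Lnp n) (fun _ w => carryCode m w) σ h)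
    (hnp : ∀ (i : ℕ) (hi : i < h.length), isNP n (prevOf isNP n (h.take i)) = true →
      ((h[i].1).headD false = true ↔ boolPair (unaryEncodeNat n) (prevOf isNP n (h.take i)) ∈ Lnp)) :
    ∀ k ≤ h.length, prevOf isNP n (h.take k) = answers isNP qry Lnp σ n k := by
  intro k
  induction k with
  | zero => intro _; rfl
  | succ k ih =>
    intro hk
    have hk' : k < h.length := hk
    rw [List.take_succ_eq_append_getElem hk', prevOf_append_singleton, ih hk'.le, answers_succ, List.append_cancel_left_eq,
      List.singleton_inj]
    -- the frame `k`
    obtain ⟨hR, hb⟩ := hv k hk'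
    simp only [List.get_eq_getElem] at hR hb
    have ha : prevOf isNP n (h.take k) = answers isNP qry Lnp σ n k := ih hk'.le
    obtain ⟨a, hw, -⟩ := hR
    rw [nextAns]
    by_cases hsel : isNP n (answers isNP qry Lnp σ n k) = true
    · rw [if_pos hsel, if_pos hsel]
      have hiff := hnp k hk' (by rw [ha]; exact hsel)
      rw [ha] at hiff
      rcases hmem : (h[k].1).headD false with _ | _
      · rw [hmem] at hiff
        exact (decide_eq_false fun hm => Bool.false_ne_true (hiff.2 hm)).symm
      · rw [hmem] at hiff
        exact (decide_eq_true (hiff.1 rfl)).symm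
    · rw [if_neg hsel, if_neg hsel, hb, hw, ha]
      congr 1
      rw [carryCode_eq_drop (by rw [List.length_cons, hq]; omega), List.length_cons, hq,
        show m + 1 - m = 1 by omega, List.drop_one, List.tail_cons]

end Strategy

/-! ### Reading the transcript in polynomial time -/

section Reading

/-- The dimension `n` of a query string `⟨1ⁿ, bits⟩` (junk on other strings). [folklore] -/
def nOf (z : List Bool) : ℕ := (fstF z).length

/-- The transcript `bits` of a query string `⟨1ⁿ, bits⟩`. [folklore] -/
def bitsOf (z : List Bool) : List Bool := sndF z

/-- Reading `n`. [folklore] -/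
@[simp] theorem nOf_boolPair (n : ℕ) (bits : List Bool) : nOf (boolPair (unaryEncodeNat n) bits) = n := by
  rw [nOf, fstF_boolPair, length_unaryEncodeNat]

/-- Reading `bits`. [folklore] -/
@[simp] theorem bitsOf_boolPair (n : ℕ) (bits : List Bool) : bitsOf (boolPair (unaryEncodeNat n) bits) = bits :=
  sndF_boolPair _ _

/-- Parsing a query string is polynomial-time. [folklore] -/
theorem parseC : CodeFP strE (pairE unE strE) (fun z => (nOf z, bitsOf z)) :=
  (strLength.comp (⟨fstF, fstF_mem_FP, fun _ => rfl⟩ : CodeFP strE strE fstF)).pair ⟨sndF, sndF_mem_FP, fun _ => rfl⟩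

/-- A string map computed on strings themselves is in `FP` (private copy of
`QuantumComplexity.ADH.PCSpec.mem_FP_of_code`, `AnnotatedPairCountsPSpace.lean` — the quantum
counting development, not imported here; a librarian may hoist it next to `CodeFP`). [folklore] -/
private theorem mem_FP_of_codeFP_strE {g : List Bool → List Bool} (h : CodeFP strE strE g) : g ∈ FP := by
  obtain ⟨f, hf, hfg⟩ := h
  have hfg' : f = g := funext hfg
  exact hfg' ▸ hf

/-- A language cut out by a typed polynomial-time bit is in `P` (private copy of
`LundEtAl1992Proofs.setOf_codeFP_mem_P`, whose file — the `MIP = NEXP` development — is not imported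
here). [cite: AroraBarak2009, Def. 1.13] -/
private theorem setOf_codeFP_mem_P' {p : List Bool → Bool} (h : CodeFP strE bitE p) :
    ({z | p z = true} : Language Bool) ∈ Classes.P := by
  obtain ⟨F, hF, hFs⟩ := h
  refine mem_P_of_mem_FP hF _ fun z => ⟨fun hz => ?_, fun hz => ?_⟩
  · rw [show F z = bitE (p z) from hFs z, show p z = true from hz]; rfl
  · rw [show F z = bitE (p z) from hFs z, Bool.eq_false_iff.2 hz]; rfl

/-- Evaluating a polynomial, unary to unary (private copy of `QuantumComplexity.unPoly_codeFP`,
`HidingProgramMachine.lean` — the hiding-program development, not imported here; a librarian may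
hoist it next to `CodeFP`). [folklore] -/
private theorem polyC (p : Polynomial ℕ) : CodeFP unE unE (fun n => p.eval n) :=
  ⟨Plumb.polyFn p, Plumb.polyFn_mem_FP p, fun n => by rw [Plumb.polyFn_apply, length_unE, unE_eq_ones]⟩

/-- The last bit of a string (`false` for the empty string). [folklore] -/
theorem lastBitC : CodeFP strE bitE (fun c : List Bool => c.getLast?.getD false) := by
  have hidx : CodeFP strE unE (fun c : List Bool => min (c.length - 1) c.length) :=
    (unOfNatMin.comp (strLength.pair (natSub.comp (strNatLength.pair (const strE 1)))) :)
  refine (strGetD.comp (hidx.pair (CodeFP.id strE))).congr fun c => ?_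
  show c.getD (min (c.length - 1) c.length) false = c.getLast?.getD false
  rw [min_eq_left (Nat.sub_le _ _), List.getLast?_eq_getElem?, List.getD_eq_getElem?_getD]

/-- The head of a string with default `true`. [folklore] -/
theorem headTrueC : CodeFP strE bitE (fun c : List Bool => c.headD true) := by
  have hemp : CodeFP strE bitE (fun c : List Bool => decide (c.length ≤ 0)) :=
    (unLeNat.comp (strLength.pair (const strE 0)) :)
  have hhead : CodeFP strE bitE (fun c : List Bool => c.getD 0 false) :=
    (strGetD.comp ((const strE 0).pair (CodeFP.id strE)) :)
  exact (hemp.or hhead).congr fun c => by cases c <;> simp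

/-- **Reading the history off a transcript** (`DrivenSignMachineUnflat.histOf`) is polynomial-time:
cut into blocks (`CodeFP.strChunks`), keep the first `s(n)` bits and the last bit of each.
[cite: AroraBarak2009, §1.3] -/
theorem histTC (s P : Polynomial ℕ) :
    CodeFP (pairE unE strE) (rawE (pairE strE bitE)) (fun p => histOf (s.eval p.1) (P.eval p.1) p.2) := by
  have hn : CodeFP (pairE unE strE) unE (fun p => p.1) := fst _ _
  have hb : CodeFP (pairE unE strE) strE (fun p => p.2) := snd _ _
  have hs : CodeFP (pairE unE strE) unE (fun p => s.eval p.1) := (polyC s).comp hn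
  have hP : CodeFP (pairE unE strE) unE (fun p => P.eval p.1) := (polyC P).comp hn
  have hlen : CodeFP (pairE unE strE) unE (fun p => p.2.length) := (strLength.comp hb :)
  have hdiv : CodeFP (pairE unE strE) natE (fun p => p.2.length / P.eval p.1) :=
    (natDiv.comp ((natOfUn.comp hlen).pair (natOfUn.comp hP)) :)
  have hN : CodeFP (pairE unE strE) unE (fun p => p.2.length / P.eval p.1) :=
    (unOfNatMin.comp (hlen.pair hdiv)).congr fun p => min_eq_left (Nat.div_le_self _ _)
  have hchunks : CodeFP (pairE unE strE) (rawE strE)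
      (fun p => (List.range (p.2.length / P.eval p.1)).map fun i => (p.2.drop (i * P.eval p.1)).take (P.eval p.1)) :=
    (strChunks.comp (hN.pair (hP.pair hb)) :)
  have hg : CodeFP (pairE unE strE) (pairE strE bitE) (fun t => (t.2.take t.1, t.2.getLast?.getD false)) :=
    strTake.pair (lastBitC.comp (snd _ _))
  refine ((map hg).comp (hs.pair hchunks)).congr fun p => ?_
  simp only [histOf, blockAt, List.map_map]
  rfl

/-- **Reading a partial block off a transcript** (`DrivenSignMachineUnflat.tailOf`) is polynomial-time.
[cite: AroraBarak2009, §1.3] -/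
theorem tailTC (P : Polynomial ℕ) : CodeFP (pairE unE strE) strE (fun p => tailOf (P.eval p.1) p.2) := by
  have hn : CodeFP (pairE unE strE) unE (fun p => p.1) := fst _ _
  have hb : CodeFP (pairE unE strE) strE (fun p => p.2) := snd _ _
  have hP : CodeFP (pairE unE strE) unE (fun p => P.eval p.1) := (polyC P).comp hn
  have hlen : CodeFP (pairE unE strE) unE (fun p => p.2.length) := (strLength.comp hb :)
  have hdiv : CodeFP (pairE unE strE) natE (fun p => p.2.length / P.eval p.1) :=
    (natDiv.comp ((natOfUn.comp hlen).pair (natOfUn.comp hP)) :)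
  have hoff : CodeFP (pairE unE strE) unE (fun p => p.2.length / P.eval p.1 * P.eval p.1) :=
    (unOfNatMin.comp (hlen.pair (natMul.comp (hdiv.pair (natOfUn.comp hP))))).congr fun p =>
      min_eq_left (Nat.div_mul_le_self _ _)
  exact (strDrop.comp (hoff.pair hb)).congr fun _ => rfl

variable {isNP : ℕ → List Bool → Bool}

/-- **Reading the answers off a history is polynomial-time** (a `CodeFP.foldl`, the accumulator
being the answer string, of length the number of frames). [cite: AroraBarak2009, §1.3 (bounded loops)] -/
theorem prevC (hisNP : CodeFP (pairE unE strE) bitE (fun p => isNP p.1 p.2)) :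
    CodeFP (pairE unE (rawE (pairE strE bitE))) strE (fun p => prevOf isNP p.1 p.2) := by
  have hn : CodeFP (pairE unE (pairE (pairE strE bitE) strE)) unE (fun t => t.1) := fst _ _
  have he1 : CodeFP (pairE unE (pairE (pairE strE bitE) strE)) strE (fun t => t.2.1.1) := (snd _ _).fst'.fst'
  have he2 : CodeFP (pairE unE (pairE (pairE strE bitE) strE)) bitE (fun t => t.2.1.2) := (snd _ _).fst'.snd'
  have hp : CodeFP (pairE unE (pairE (pairE strE bitE) strE)) strE (fun t => t.2.2) := (snd _ _).snd'
  have hsel : CodeFP (pairE unE (pairE (pairE strE bitE) strE)) bitE (fun t => isNP t.1 t.2.2) :=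
    (hisNP.comp (hn.pair hp) :)
  have h0 : CodeFP (pairE unE (pairE (pairE strE bitE) strE)) unE (fun _ => 0) := const _ _
  have hhead : CodeFP (pairE unE (pairE (pairE strE bitE) strE)) bitE (fun t => t.2.1.1.getD 0 false) :=
    (strGetD.comp (h0.pair he1) :)
  have hbit : CodeFP (pairE unE (pairE (pairE strE bitE) strE)) bitE
      (fun t => if isNP t.1 t.2.2 then t.2.1.1.headD false else t.2.1.2) :=
    (ite hsel hhead he2).congr fun t => by
      obtain ⟨n, ⟨w, b⟩, p⟩ := t
      cases w <;> rfl
  have hone : CodeFP bitE strE (fun b : Bool => [b]) := (CodeFP.id bitE).recodeOut fun _ => rfl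
  have hstep : CodeFP (pairE unE (pairE (pairE strE bitE) strE)) strE
      (fun t => t.2.2 ++ [if isNP t.1 t.2.2 then t.2.1.1.headD false else t.2.1.2]) :=
    (strAppend.comp (hp.pair (hone.comp hbit)) :)
  have hfold := foldl (σ := ℕ) (α := List Bool × Bool) (β := List Bool) (eσ := unE) (eα := pairE strE bitE)
    (eβ := strE) (step := fun n e p => p ++ [if isNP n p then e.1.headD false else e.2]) (init := fun _ => [])
    hstep (const unE []) X (fun n l₁ l₂ => by
      rw [eval_X]
      show (prevOf isNP n l₁).length ≤ (boolPair (unE n) (rawE (pairE strE bitE) (l₁ ++ l₂))).length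
      rw [length_prevOf, length_boolPair]
      have h1 : l₁.length ≤ (l₁ ++ l₂).length := by simp
      have h2 := length_le_length_rawE (pairE strE bitE) (l₁ ++ l₂)
      omega)
  exact hfold.congr fun _ => rfl

variable (isNP) (qry : ℕ → List Bool → List Bool) (m : Polynomial ℕ)

/-- The history of a query string `⟨1ⁿ, bits⟩` (witness length `m + 1`, period `2m + 2`). [folklore] -/
noncomputable def histStr (z : List Bool) : List (List Bool × Bool) :=
  histOf ((m + 1).eval (nOf z)) ((period (m + 1) m).eval (nOf z)) (bitsOf z)

/-- The answers of a query string. [folklore] -/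
noncomputable def prevStr (z : List Bool) : List Bool := prevOf isNP (nOf z) (histStr m z)

/-- The `NP` query string `⟨1ⁿ, prev⟩` of a query string. [folklore] -/
noncomputable def pairStr (z : List Bool) : List Bool := boolPair (unaryEncodeNat (nOf z)) (prevStr isNP m z)

/-- The partial block of a query string. [folklore] -/
noncomputable def tailStr (z : List Bool) : List Bool := tailOf ((period (m + 1) m).eval (nOf z)) (bitsOf z)

/-- The prefix-match test on a partial block `tl` against the probe `Q`: `tl` is empty, or
`tl.tail ++ [1]` is a prefix of `Q`. [folklore] -/
def matchPair (tl Q : List Bool) : Bool :=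
  decide (tl.length ≤ 0) || decide (Q.take tl.length = tl.tail ++ [true])

/-- The guard bit of a query string: the partial block is empty or starts with `1`. [folklore] -/
noncomputable def guardB (z : List Bool) : Bool := (tailStr m z).headD true

/-- The match bit of a query string. [folklore] -/
noncomputable def matchB (z : List Bool) : Bool := matchPair (tailStr m z) (qry (nOf z) (prevStr isNP m z))

/-- The selector bit of a query string: the current question is an `NP` question. [folklore] -/
noncomputable def isNPB (z : List Bool) : Bool := isNP (nOf z) (prevStr isNP m z)

variable {isNP qry m}

/-- The prefix-match test is correct. [folklore] -/
theorem matchPair_eq_true_iff (tl Q : List Bool) : matchPair tl Q = true ↔ (tl ≠ [] → tl.tail ++ [true] <+: Q) := by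
  cases tl with
  | nil => simp [matchPair]
  | cons c t =>
    have h1 : matchPair (c :: t) Q = decide (Q.take (t.length + 1) = t ++ [true]) := by simp [matchPair]
    rw [h1, decide_eq_true_iff, List.tail_cons, List.prefix_iff_eq_take, List.length_append, List.length_singleton]
    exact ⟨fun h _ => h.symm, fun h => (h (List.cons_ne_nil c t)).symm⟩

/-- The prefix-match test is polynomial-time. [cite: AroraBarak2009, §1.3] -/
theorem matchPairC : CodeFP (pairE strE strE) bitE (fun p => matchPair p.1 p.2) := by
  have htl : CodeFP (pairE strE strE) strE (fun p => p.1) := fst _ _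
  have hQ : CodeFP (pairE strE strE) strE (fun p => p.2) := snd _ _
  have hlen : CodeFP (pairE strE strE) unE (fun p => p.1.length) := (strLength.comp htl :)
  have hemp : CodeFP (pairE strE strE) bitE (fun p => decide (p.1.length ≤ 0)) :=
    (unLeNat.comp (hlen.pair (const _ 0)) :)
  have htake : CodeFP (pairE strE strE) strE (fun p => p.2.take p.1.length) := (strTake.comp (hlen.pair hQ) :)
  have htail : CodeFP (pairE strE strE) strE (fun p => p.1.drop 1) := (strDrop.comp ((const _ 1).pair htl) :)
  have hrhs : CodeFP (pairE strE strE) strE (fun p => p.1.drop 1 ++ [true]) :=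
    (strAppend.comp (htail.pair (const _ [true])) :)
  have heq : CodeFP (pairE strE strE) bitE (fun p => decide (p.2.take p.1.length = p.1.drop 1 ++ [true])) :=
    ((eq (eα := strE) fun _ _ h => h).comp (htake.pair hrhs) :)
  exact (hemp.or heq).congr fun p => by rw [matchPair, List.drop_one]

/-- Reading the answers off a query string is polynomial-time. [cite: AroraBarak2009, §1.3] -/
theorem prevStrC (hisNP : CodeFP (pairE unE strE) bitE (fun p => isNP p.1 p.2)) : CodeFP strE strE (prevStr isNP m) :=
  (((prevC hisNP).comp ((fst _ _).pair (histTC (m + 1) (period (m + 1) m)))).comp parseC :)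

/-- The `NP` query string is computed in polynomial time. [cite: AroraBarak2009, §1.3] -/
theorem pairStr_mem_FP (hisNP : CodeFP (pairE unE strE) bitE (fun p => isNP p.1 p.2)) : pairStr isNP m ∈ FP := by
  have h : CodeFP strE (pairE unE strE) (fun z => (nOf z, prevStr isNP m z)) := parseC.fst'.pair (prevStrC hisNP)
  exact mem_FP_of_codeFP_strE (h.recodeOut fun _ => rfl)

/-- The partial block is computed in polynomial time. [cite: AroraBarak2009, §1.3] -/
theorem tailStrC : CodeFP strE strE (tailStr m) := ((tailTC (period (m + 1) m)).comp parseC :)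

/-- The guard bit is polynomial-time. [cite: AroraBarak2009, §1.3] -/
theorem guardBC : CodeFP strE bitE (guardB m) := (headTrueC.comp tailStrC :)

/-- The match bit is polynomial-time. [cite: AroraBarak2009, §1.3] -/
theorem matchBC (hisNP : CodeFP (pairE unE strE) bitE (fun p => isNP p.1 p.2))
    (hqry : CodeFP (pairE unE strE) strE (fun p => qry p.1 p.2)) : CodeFP strE bitE (matchB isNP qry m) :=
  (matchPairC.comp (tailStrC.pair (hqry.comp (parseC.fst'.pair (prevStrC hisNP)))) :)

/-- The selector bit is polynomial-time. [cite: AroraBarak2009, §1.3] -/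
theorem isNPBC (hisNP : CodeFP (pairE unE strE) bitE (fun p => isNP p.1 p.2)) : CodeFP strE bitE (isNPB isNP m) :=
  (hisNP.comp (parseC.fst'.pair (prevStrC hisNP)) :)

/-- **The readings on a transcript of the strategy.** For a history `h` with witnesses of length
`m(n) + 1` and a partial block `p` shorter than the period: the history, the answers and the partial
block read off `⟨1ⁿ, flat h ++ p⟩` are `h`, `prevOf h` and `p`. [folklore] -/
theorem readings_flat {n : ℕ} {h : List (List Bool × Bool)} {p : List Bool}
    (hs : ∀ e ∈ h, e.1.length = m.eval n + 1) (hp : p.length < (m.eval n + 1) + m.eval n + 1) :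
    prevStr isNP m (boolPair (unaryEncodeNat n) (flat (fun _ w => carryCode (m.eval n) w) h ++ p)) = prevOf isNP n h ∧
      tailStr m (boolPair (unaryEncodeNat n) (flat (fun _ w => carryCode (m.eval n) w) h ++ p)) = p := by
  have hP : (period (m + 1) m).eval n = (m.eval n + 1) + m.eval n + 1 := by simp [period]
  have hs1 : (m + 1 : Polynomial ℕ).eval n = m.eval n + 1 := by simp
  refine ⟨?_, ?_⟩
  · rw [prevStr, histStr, nOf_boolPair, bitsOf_boolPair, hP, hs1,
      histOf_flat_append (fun _ w => length_carryCode _ w) h p hs hp]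
  · rw [tailStr, nOf_boolPair, bitsOf_boolPair, hP, tailOf_flat_append (fun _ w => length_carryCode _ w) h p hs hp]

end Reading

/-! ### The driver language of a protocol -/

section Driver

variable (isNP : ℕ → List Bool → Bool) (qry : ℕ → List Bool → List Bool) (Lnp Lfin : Language Bool) (m K : Polynomial ℕ)

/-- **The search language**: the match bit is set and, under the guard, the current question is an
`NP` question whose statement holds. [cite: FournierKoiran2000, §2 (p. 4) and §2.1] -/
def protoSearch : Language Bool :=
  {z | matchB isNP qry m z = true} ⊓ ({z | guardB m z = true}ᶜ ⊔ ({z | isNPB isNP m z = true} ⊓ pairStr isNP m ⁻¹' Lnp))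

/-- **The verdict language**: the final statement on the answers of the full transcript.
[cite: FournierKoiran2000, Thm 3 (p. 11)] -/
def protoFinal : Language Bool := pairStr isNP m ⁻¹' Lfin

/-- **The driver of the protocol** (`DrivenSignMachineDriver.driverLang` with the generic
transmission language of `DrivenSignMachineCarry`). [cite: FournierKoiran2000, Thm 3 (p. 11)] -/
def protoDriver : Language Bool :=
  driverLang (m + 1) m K (protoSearch isNP qry Lnp m) (TransLang m) (protoFinal isNP Lfin m)

variable {isNP qry Lnp Lfin m K}

/-- **The search language is in `NP`** (closure of `Σ₁ᵖ` under `∩`, `∪` with `P` languages and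
polynomial-time preimages). [cite: AroraBarak2009, Def. 5.3] -/
theorem protoSearch_mem_NP (hisNP : CodeFP (pairE unE strE) bitE (fun p => isNP p.1 p.2))
    (hqry : CodeFP (pairE unE strE) strE (fun p => qry p.1 p.2)) (hLnp : Lnp ∈ Nondeterministic.NP) :
    protoSearch isNP qry Lnp m ∈ Nondeterministic.NP := by
  obtain ⟨hpre, hinter, hunion⟩ := SigmaP_closure 1
  rw [← SigmaP_one_holds] at hLnp ⊢
  refine hinter (setOf_codeFP_mem_P' (matchBC hisNP hqry)) (hunion ?_ (hinter (setOf_codeFP_mem_P' (isNPBC hisNP))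
    (hpre hLnp (pairStr_mem_FP hisNP))))
  exact compl_mem_P_iff.2 (setOf_codeFP_mem_P' guardBC)

/-- **The verdict language is in `NP`.** [cite: AroraBarak2009, Thm 2.8] -/
theorem protoFinal_mem_NP (hisNP : CodeFP (pairE unE strE) bitE (fun p => isNP p.1 p.2)) (hLfin : Lfin ∈ Nondeterministic.NP) :
    protoFinal isNP Lfin m ∈ Nondeterministic.NP :=
  preimage_mem_NP hLfin (pairStr_mem_FP hisNP)

/-- **The driver is in `NP`.** [cite: FournierKoiran2000, Thm 3 (p. 11)] -/
theorem protoDriver_mem_NP (hisNP : CodeFP (pairE unE strE) bitE (fun p => isNP p.1 p.2))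
    (hqry : CodeFP (pairE unE strE) strE (fun p => qry p.1 p.2)) (hLnp : Lnp ∈ Nondeterministic.NP)
    (hLfin : Lfin ∈ Nondeterministic.NP) : protoDriver isNP qry Lnp Lfin m K ∈ Nondeterministic.NP :=
  driverLang_mem_NP (protoSearch_mem_NP hisNP hqry hLnp) TransLang_mem_P (protoFinal_mem_NP hisNP hLfin)

/-- **The search language answers the prefix-search questions of the strategy.**
[cite: FournierKoiran2000, §2.1 (prefix search with an `NP` oracle)] -/
theorem mem_protoSearch_iff {n : ℕ} (hq : ∀ prev, (qry n prev).length = m.eval n)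
    {h : List (List Bool × Bool)} {p : List Bool}
    (hs : ∀ e ∈ h, e.1.length = m.eval n + 1) (hp : p.length < m.eval n + 1) :
    boolPair (unaryEncodeNat n) (flat (fun _ w => carryCode (m.eval n) w) h ++ p) ∈ protoSearch isNP qry Lnp m ↔
      PrefixExtendable (protoR isNP qry Lnp n h) (m.eval n + 1) (p ++ [true]) := by
  obtain ⟨hprev, htail⟩ := readings_flat (isNP := isNP) hs (by omega : p.length < (m.eval n + 1) + m.eval n + 1)
  rw [prefixExtendable_protoR_iff hq]
  change (matchB isNP qry m _ = true ∧ (¬ guardB m _ = true ∨ (isNPB isNP m _ = true ∧ pairStr isNP m _ ∈ Lnp))) ↔ _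
  rw [matchB, guardB, isNPB, pairStr, htail, hprev, nOf_boolPair, matchPair_eq_true_iff]
  constructor
  · rintro ⟨hm, hg⟩
    refine ⟨fun hhd => ?_, hm⟩
    rcases hg with hg | hg
    · exact absurd hhd hg
    · exact hg
  · rintro ⟨hg, hm⟩
    refine ⟨hm, ?_⟩
    by_cases hhd : p.headD true = true
    · exact Or.inr (hg hhd)
    · exact Or.inl hhd

/-- **The verdict language on a full transcript** reads the final statement on the answers.
[cite: FournierKoiran2000, Thm 3 (p. 11)] -/
theorem mem_protoFinal_iff {n : ℕ} {h : List (List Bool × Bool)} (hs : ∀ e ∈ h, e.1.length = m.eval n + 1) :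
    boolPair (unaryEncodeNat n) (flat (fun _ w => carryCode (m.eval n) w) h) ∈ protoFinal isNP Lfin m ↔
      boolPair (unaryEncodeNat n) (prevOf isNP n h) ∈ Lfin := by
  obtain ⟨hprev, -⟩ := readings_flat (isNP := isNP) (p := []) hs (by rw [List.length_nil]; omega)
  rw [List.append_nil] at hprev
  change pairStr isNP m _ ∈ Lfin ↔ _
  rw [pairStr, hprev, nOf_boolPair]

end Driver

/-! ### The heads of the witnesses are driver bits -/

section Heads

variable {code : List (List Bool × Bool) → List Bool → List Bool}

/-- `flat` is monotone for the prefix order. [folklore] -/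
theorem flat_prefix {h₁ h₂ : List (List Bool × Bool)} (hp : h₁ <+: h₂) : flat code h₁ <+: flat code h₂ := by
  induction h₂ using List.reverseRecOn with
  | nil =>
    obtain rfl := List.prefix_nil.1 hp
    exact List.prefix_rfl
  | append_singleton h₂ e ih =>
    rcases List.prefix_concat_iff.1 hp with rfl | hp'
    · exact List.prefix_rfl
    · obtain ⟨w, b⟩ := e
      rw [flat_append_singleton]
      exact (ih hp').trans (List.prefix_append _ _)

/-- A prefix of a valid history is valid. [folklore] -/
theorem ValidHist.take {R : List (List Bool × Bool) → List Bool → Prop} {σ : List Bool → Bool}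
    {h : List (List Bool × Bool)} (hv : ValidHist R code σ h) (k : ℕ) : ValidHist R code σ (h.take k) := by
  intro i hi
  have hik : i < k := by
    rw [List.length_take] at hi
    exact lt_of_lt_of_le hi (min_le_left _ _)
  have hi' : i < h.length := by
    rw [List.length_take] at hi
    exact lt_of_lt_of_le hi (min_le_right _ _)
  have hget : (h.take k).get ⟨i, hi⟩ = h.get ⟨i, hi'⟩ := by simp [List.getElem_take]
  rw [hget, List.take_take, min_eq_left hik.le]
  exact hv i hi'

/-- **The head of the witness of frame `i` is the driver's bit after the transcript of the first `i`
frames**, when the stream of the driven machine is the transcript of the history (period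
`P = s + m + 1 ≥ 2`: the first round of a frame is a driver round). [cite: FournierKoiran2000, §2 (p. 4)] -/
theorem headD_witness_eq_driver {δ σ : List Bool → Bool} {s m K : ℕ} (hcode : ∀ h w, (code h w).length = m)
    (hs1 : 1 ≤ s) {h : List (List Bool × Bool)} (hlen : h.length = K) (hsz : ∀ e ∈ h, e.1.length = s)
    (hstream : stream δ σ m (s + m + 1) (K * (s + m + 1)) (K * (s + m + 1)) = flat code h)
    {i : ℕ} (hi : i < h.length) :
    (h[i].1).headD false = δ (flat code (h.take i)) := by
  -- transcripts of prefixes are prefixes of the transcript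
  have hflen : ∀ k ≤ h.length, (flat code (h.take k)).length = k * (s + m + 1) := fun k hk => by
    rw [length_flat hcode _ (fun e he => hsz e (List.mem_of_mem_take he)), List.length_take, min_eq_left hk]
  have htake : ∀ k ≤ h.length, flat code (h.take k) = (flat code h).take (k * (s + m + 1)) := fun k hk => by
    rw [List.prefix_iff_eq_take.1 (flat_prefix (code := code) (List.take_prefix k h)), hflen k hk]
  -- the bit at position `i P` of the transcript is the head of the witness of frame `i`
  have hw : h[i].1 ≠ [] := fun h0 => by
    have := hsz h[i] (List.getElem_mem hi)
    rw [h0] at this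
    simp at this
    omega
  have hhead : ∀ w rest : List Bool, w ≠ [] → (w ++ rest).getD 0 false = w.headD false := by
    intro w rest hw0
    cases w with
    | nil => exact absurd rfl hw0
    | cons b t => rfl
  have hbit : (flat code h).getD (i * (s + m + 1)) false = (h[i].1).headD false := by
    have hdec : flat code h = flat code (h.take i) ++ ((h[i].1 ++ code (h.take i) h[i].1 ++ [h[i].2]) ++
        (flat code h).drop ((i + 1) * (s + m + 1))) := by
      rw [← List.append_assoc, ← flat_append_singleton, (Prod.mk.eta : (h[i].1, h[i].2) = h[i]),
        ← List.take_succ_eq_append_getElem hi, htake (i + 1) hi, List.take_append_drop]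
    rw [hdec, List.getD_append_right _ _ _ _ (hflen i hi.le).le, hflen i hi.le, Nat.sub_self,
      List.append_assoc, List.append_assoc, hhead _ _ hw]
  -- the same bit of the stream is a driver bit
  have hP2 : 2 ≤ s + m + 1 := by omega
  have hiK : i < K := hlen ▸ hi
  have hT : i * (s + m + 1) + 1 ≤ K * (s + m + 1) := by
    have := Nat.mul_le_mul_right (s + m + 1) (Nat.succ_le_of_lt hiK)
    rw [Nat.succ_mul] at this
    omega
  have hdrive : stream δ σ m (s + m + 1) (K * (s + m + 1)) (i * (s + m + 1) + 1) =
      stream δ σ m (s + m + 1) (K * (s + m + 1)) (i * (s + m + 1)) ++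
        [δ (stream δ σ m (s + m + 1) (K * (s + m + 1)) (i * (s + m + 1)))] := by
    refine stream_succ_of_drive fun hc => ?_
    have h1 : (i * (s + m + 1) + 1) % (s + m + 1) = 1 := by
      rw [Nat.add_comm, Nat.add_mul_mod_self_right, Nat.mod_eq_of_lt (by omega)]
    rw [h1] at hc
    exact absurd hc.2 Nat.one_ne_zero
  have hsbit : (flat code h).getD (i * (s + m + 1)) false = δ (flat code (h.take i)) := by
    have hle : i * (s + m + 1) ≤ K * (s + m + 1) := Nat.mul_le_mul_right _ hiK.le
    rw [htake i hi.le, ← hstream, stream_take hle, List.getD_eq_getElem?_getD,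
      ← List.getElem?_take_of_lt (Nat.lt_succ_self _), stream_take hT, hdrive,
      List.getElem?_append_right (length_stream _).le, length_stream, Nat.sub_self]
    rfl
  rw [← hbit, hsbit]

end Heads

/-! ### Main theorem -/

section Main

variable {isNP : ℕ → List Bool → Bool} {qry : ℕ → List Bool → List Bool} {Lnp Lfin : Language Bool}

/-- **Every polynomial one-bit protocol with `NP` and sign questions runs in `P⁰_ℝovs(NP)`.** If the
selector `isNP` and the probe `qry` are polynomial-time in `⟨1ⁿ, prev⟩`, the probes have length
`m(n)`, the statements `Lnp` and the verdict `Lfin` are `NP` languages, and membership of `x` in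
`L n` is the verdict on the answers to the `K(n)` questions against the sign environment of `x`,
then `L ∈ PAddRelClass NP` — the oracle being the driver `protoDriver`, the machine the universal
driven sign machine. [cite: FournierKoiran2000, Thm 3 (p. 11), with §2 (p. 4)] -/
theorem mem_PAddRelClass_NP_of_protocol (m K : Polynomial ℕ) {L : RealLanguage}
    (hisNP : CodeFP (pairE unE strE) bitE (fun p => isNP p.1 p.2))
    (hqry : CodeFP (pairE unE strE) strE (fun p => qry p.1 p.2))
    (hqlen : ∀ n prev, (qry n prev).length = m.eval n)
    (hLnp : Lnp ∈ Nondeterministic.NP) (hLfin : Lfin ∈ Nondeterministic.NP)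
    (hL : ∀ (n : ℕ) (x : Fin n → ℝ),
      x ∈ L n ↔ boolPair (unaryEncodeNat n) (answers isNP qry Lnp (signEnv x) n (K.eval n)) ∈ Lfin) :
    L ∈ PAddRelClass Nondeterministic.NP := by
  refine mem_PAddRelClass_of_driver m (m + 1 + m + 1) (K * (m + 1 + m + 1))
    (protoDriver_mem_NP (m := m) (K := K) hisNP hqry hLnp hLfin) L fun n x => ?_
  -- the parameters at dimension `n`
  have hs : (m + 1 : Polynomial ℕ).eval n = m.eval n + 1 := by simp
  have hP : (m + 1 + m + 1 : Polynomial ℕ).eval n = (m.eval n + 1) + m.eval n + 1 := by simp only [eval_add, eval_one]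
  have hT : (K * (m + 1 + m + 1) : Polynomial ℕ).eval n = K.eval n * ((m.eval n + 1) + m.eval n + 1) := by
    simp only [eval_mul, eval_add, eval_one]
  -- the strategy at dimension `n` and its implementation by the driver
  have hcode : ∀ (h : List (List Bool × Bool)) (w : List Bool),
      ((fun (_ : List (List Bool × Bool)) (w : List Bool) => carryCode (m.eval n) w) h w).length = m.eval n :=
    fun _ w => length_carryCode _ w
  have hsR : ∀ (h : List (List Bool × Bool)) (w : List Bool), protoR isNP qry Lnp n h w → w.length = (m + 1 : Polynomial ℕ).eval n :=
    fun h w hw => by rw [hs]; exact length_of_protoR (hqlen n) hw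
  have hS : ∀ (h : List (List Bool × Bool)) (p : List Bool), h.length < K.eval n →
      ValidHist (protoR isNP qry Lnp n) (fun _ w => carryCode (m.eval n) w) (signEnv x) h → p.length < (m + 1 : Polynomial ℕ).eval n →
        (boolPair (unaryEncodeNat n) (flat (fun _ w => carryCode (m.eval n) w) h ++ p) ∈ protoSearch isNP qry Lnp m ↔
          PrefixExtendable (protoR isNP qry Lnp n h) ((m + 1 : Polynomial ℕ).eval n) (p ++ [true])) := by
    intro h p _ hv hp
    rw [hs] at hp ⊢
    exact mem_protoSearch_iff (hqlen n) (fun e he => by rw [← hs]; exact hv.length_eq hsR e he) hp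
  have himpl := implements_driverLang_carry (s := m + 1) (m := m) (F := K) (Lfinal := protoFinal isNP Lfin m)
    (σ := signEnv x) (n := n) (by rw [hs]; exact Nat.le_succ _) hsR hS
  have hex : ∀ h : List (List Bool × Bool), h.length < K.eval n →
      ValidHist (protoR isNP qry Lnp n) (fun _ w => carryCode (m.eval n) w) (signEnv x) h →
        ∃ w : List Bool, w.length = (m + 1 : Polynomial ℕ).eval n ∧ protoR isNP qry Lnp n h w :=
    fun h _ _ => by rw [hs]; exact exists_protoR (hqlen n) h
  obtain ⟨h, hlen, hv, hstream⟩ := exists_validHist_stream_T himpl hcode hsR hex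
  have hsz : ∀ e ∈ h, e.1.length = m.eval n + 1 := fun e he => by rw [← hs]; exact hv.length_eq hsR e he
  rw [hs] at hstream
  rw [protoDriver, hP, hT, hstream, mem_driverLang_flat_iff hcode hsR hlen hv, mem_protoFinal_iff hsz, hL n x]
  -- the answers of the history are the answers of the protocol
  suffices hprev : prevOf isNP n h = answers isNP qry Lnp (signEnv x) n (K.eval n) by rw [hprev]
  -- the head of the witness of an `NP` frame `i` is the driver's answer to the first search question
  have hnp : ∀ (i : ℕ) (hi : i < h.length), isNP n (prevOf isNP n (h.take i)) = true →
      ((h[i].1).headD false = true ↔ boolPair (unaryEncodeNat n) (prevOf isNP n (h.take i)) ∈ Lnp) := by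
    intro i hi hsel
    have hδ : driverOf (driverLang (m + 1) m K (protoSearch isNP qry Lnp m) (TransLang m) (protoFinal isNP Lfin m)) n
        (flat (fun _ w => carryCode (m.eval n) w) (h.take i)) = true ↔
        boolPair (unaryEncodeNat n) (flat (fun _ w => carryCode (m.eval n) w) (h.take i)) ∈
          driverLang (m + 1) m K (protoSearch isNP qry Lnp m) (TransLang m) (protoFinal isNP Lfin m) :=
      (Set.mem_iff_boolIndicator _ _).symm
    rw [headD_witness_eq_driver hcode (Nat.succ_le_succ (Nat.zero_le _)) hlen hsz hstream hi, hδ]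
    have hli : (h.take i).length = i := by rw [List.length_take, min_eq_left hi.le]
    have hszi : ∀ e ∈ h.take i, e.1.length = m.eval n + 1 := fun e he => hsz e (List.mem_of_mem_take he)
    have hfl : (flat (fun _ w => carryCode (m.eval n) w) (h.take i)).length = i * ((m.eval n + 1) + m.eval n + 1) := by
      rw [length_flat hcode _ hszi, hli]
    have hiK : i < K.eval n := hlen ▸ hi
    rw [mem_driverLang_of_search (Lsearch := protoSearch isNP qry Lnp m) (Ltrans := TransLang m)
        (Lfinal := protoFinal isNP Lfin m) ?_ ?_]
    · have key := mem_protoSearch_iff (isNP := isNP) (Lnp := Lnp) (p := []) (hqlen n) hszi (by rw [List.length_nil]; omega)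
      rw [List.append_nil] at key
      rw [key, prefixExtendable_protoR_iff (hqlen n)]
      constructor
      · rintro ⟨h1, -⟩
        exact (h1 rfl).2
      · intro hm
        exact ⟨fun _ => ⟨hsel, hm⟩, fun hne => absurd rfl hne⟩
    · rw [hfl, hs]
      intro heq
      have h1 : i * ((m.eval n + 1) + m.eval n + 1) < K.eval n * ((m.eval n + 1) + m.eval n + 1) :=
        Nat.mul_lt_mul_of_pos_right hiK (by omega)
      omega
    · rw [hfl, hs, Nat.mul_mod_left]
      omega
  have key := prevOf_take_eq_answers (σ := signEnv x) (hqlen n) hv hnp h.length le_rfl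
  rwa [List.take_length, hlen] at key

end Main

end FKTransfer

end Literature.Computability.Complexity
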